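import Summits.SmoothPoincare4.SmoothPoincare4.Theorems.CongruenceShadowsAgkCor6SufficiencyStubCoreIndependenceHelpers
import Summits.SmoothPoincare4.SmoothPoincare4.Theorems.CongruenceShadowsAgkCor6SufficiencyStubCoreIndependencePush
import Literature.Topology.FourManifolds.LevelTranslation

/-!
# Stub `stub_coreIndependence` of line `lp-by-sphere-system-surgery` for crux `AgkCor6Sufficiency`
(item stmt-SmoothPoincare4-10894, routes CongruenceShadows / GroupTrisection; lead reshape r5)

**Core independence.**  For a compact smooth `(n+2)`-manifold with boundary `W`, a boundary
datum `b`, two open collar data `c`, `ĉ` of `b` (`BoundaryData.OpenCollarData`,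
`CollarCriterion.lean`) and two levels `a, â ∈ (0, 1)`, some self-diffeomorphism `Φ` of `W`,
equal to the identity off a compact subset of the interior, carries the open collar end
`c (∂W × [0, a))` onto `ĉ (∂W × [0, â))`.  Proof (uniqueness of collars + regular interval
theorem; no transversality computation):

1. by the ambient uniqueness of collars with controlled support
   (`…StubCoreIndependenceHelpers.lean`, after the tree's `CobordismEndCollarMatching.lean`,
   Bröcker–Jänich (1982), (13.7)) there is a self-diffeomorphism `Ψ` of `W`, equal to the
   identity off the open neighbourhood `N = c (∂W × [0, a))` of `∂W` — so `Ψ (N) = N` — with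
   `Ψ (c x t) = ĉ x t` for `0 ≤ t < δ` (the carrier of `b` is identified with the subtype `∂W`
   through the smooth embedding `b.incl`, `contMDiff_of_comp_isSmoothEmbedding`);
2. by Milnor's regular interval theorem along the collar-height functions
   (`…StubCoreIndependencePush.lean`) there are self-diffeomorphisms `P`, `Q` of `W` supported
   in compact subsets of the interior with `P (c (∂W × [0, t₀))) = c (∂W × [0, a))` and
   `Q (ĉ (∂W × [0, t₀))) = ĉ (∂W × [0, â))`, `t₀ < δ`;
3. `Φ = Q ∘ Ψ ∘ P⁻¹ ∘ Ψ⁻¹` is the identity off `Ψ (K_P) ∪ K_Q` (a conjugate of an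
   interior-supported diffeomorphism is interior-supported, `Diffeomorph.image_interior`) and
   `Φ (N) = Q (Ψ (P⁻¹ N)) = Q (Ψ (c (∂W × [0, t₀)))) = Q (ĉ (∂W × [0, t₀))) = ĉ (∂W × [0, â))`.

This file declares the line's statement `CoreIndependence` (verbatim from the checked skeleton)
and proves the registered stub `stub_coreIndependence`.  References: Bröcker–Jänich,
*Introduction to Differential Topology* (1982), (13.7) [BrockerJanich1982]; J. Milnor, *Morse
theory* (1963), Thm. 3.1 [Milnor1963].
-/

noncomputable section

-- the prescribed namespace `Summit.<P>.<Sub>.…` duplicates `SmoothPoincare4` (P = Sub)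
set_option linter.dupNamespace false

open Set Function ContinuousMap
open scoped Manifold ContDiff Topology

namespace Summit.SmoothPoincare4.SmoothPoincare4.Cruxes.AgkCor6Sufficiency.LpBySphereSystemSurgery

open Literature.Topology.FourManifolds

/-! ## The statement (verbatim from the skeleton) -/

/-- **Core independence** (r5; previously the lead's target (P5), `PrismRigidityTargets.lean`): for
a compact smooth `(n+2)`-manifold with boundary `W`, a boundary datum `b`, two open collars
`c, ĉ` of `b` (`BoundaryData.OpenCollarData`: collar map with smooth height and projection) and
two levels `a, â ∈ (0, 1)`, there is a self-diffeomorphism `Φ` of `W`, equal to the identity off a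
compact subset of the interior, carrying the open collar end `c(∂W × [0, a))` onto
`ĉ(∂W × [0, â))`.  (The `ĉ`-height increases strictly along the `c`-lines near `∂W` (both collars
enter the interior transversally), so for `â` small — reached first by pushing down along the
regular function `ĉ.height` — the function `θ = λ(t)·K t + (1 - λ(t))·(ĉ.height)` of the
`c`-coordinates `(x, t)` has `∂ₜθ > 0`, `{θ < â} = ĉ(∂W × [0, â))` and `{θ < K a} = c(∂W × [0, a))`;
push down along the regular interval `[â, K a]` of `θ` by a flow compactly supported in the
interior.) -/
def CoreIndependence : Prop :=
  ∀ (n : ℕ) (W : Type) [TopologicalSpace W] [T2Space W] [SecondCountableTopology W]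
    [CompactSpace W] [ChartedSpace (EuclideanHalfSpace (n + 2)) W] [IsManifold (𝓡∂ (n + 2)) ∞ W]
    (b : BoundaryData (𝓡∂ (n + 2)) W (𝓡 (n + 1))) (c ĉ : b.OpenCollarData) (a â : ℝ),
    0 < a → a < 1 → 0 < â → â < 1 →
    ∃ Φ : W ≃ₘ⟮𝓡∂ (n + 2), 𝓡∂ (n + 2)⟯ W,
      (∃ K : Set W, IsCompact K ∧ K ⊆ (𝓡∂ (n + 2)).interior W ∧ ∀ w, w ∉ K → Φ w = w) ∧
      Φ '' (c.collarMap '' {p | (p.2 : ℝ) < a}) = ĉ.collarMap '' {p | (p.2 : ℝ) < â}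

/-! ## Helpers: the collars of `b` as explicit collars of the subtype `∂W` -/

namespace CoreIndependence

section Wrapper

variable {n : ℕ} {W : Type} [TopologicalSpace W] [ChartedSpace (EuclideanHalfSpace (n + 2)) W]
  (b : BoundaryData (𝓡∂ (n + 2)) W (𝓡 (n + 1)))

/-- The identification `∂W → b.carrier` (lift of the inclusion of the subtype `∂W` through the
embedding `b.incl`, whose range is `∂W`). [folklore] -/
def toCarrier : ↥((𝓡∂ (n + 2)).boundary W) → b.carrier :=
  liftOfRange b.incl b.injective_incl Subtype.val fun m => by rw [b.range_incl]; exact m.2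

/-- The identification `b.carrier → ∂W`, `x ↦ incl x`. [folklore] -/
def ofCarrier (x : b.carrier) : ↥((𝓡∂ (n + 2)).boundary W) := ⟨b.incl x, b.incl_mem_boundary x⟩

/-- `incl (toCarrier m) = m`. [folklore] -/
theorem incl_toCarrier (m : ↥((𝓡∂ (n + 2)).boundary W)) : b.incl (toCarrier b m) = m.val :=
  apply_liftOfRange _ _ _ _ m

/-- `toCarrier (incl x) = x`. [folklore] -/
theorem toCarrier_ofCarrier (x : b.carrier) : toCarrier b (ofCarrier b x) = x :=
  liftOfRange_apply_eq _ _ _ _ rfl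

/-- `ofCarrier (toCarrier m) = m`. [folklore] -/
theorem ofCarrier_toCarrier (m : ↥((𝓡∂ (n + 2)).boundary W)) : ofCarrier b (toCarrier b m) = m :=
  Subtype.ext (incl_toCarrier b m)

variable [IsManifold (𝓡∂ (n + 2)) ∞ W]

/-- `toCarrier` is smooth (lift of the smooth `Subtype.val` through the smooth embedding
`b.incl`). [folklore] -/
theorem contMDiff_toCarrier : ContMDiff (𝓡 (n + 1)) (𝓡 (n + 1)) ∞ (toCarrier b) :=
  contMDiff_liftOfRange b.isSmoothEmbedding _
    (BoundaryManifold.isSmoothEmbedding_subtype_val (n := n + 1) (W := W)).contMDiff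

/-- `ofCarrier` is smooth (its composite with the smooth embedding `Subtype.val` is `b.incl`).
[folklore] -/
theorem contMDiff_ofCarrier : ContMDiff (𝓡 (n + 1)) (𝓡 (n + 1)) ∞ (ofCarrier b) :=
  contMDiff_of_comp_isSmoothEmbedding
    (BoundaryManifold.isSmoothEmbedding_subtype_val (n := n + 1) (W := W))
    b.isSmoothEmbedding.contMDiff

variable [T2Space W] [CompactSpace W]

/-- **Two open collar data of `b` are matched near `∂W` by a diffeomorphism of `W` supported in
a prescribed open neighbourhood of `∂W`** (uniqueness of collars, Bröcker–Jänich (1982),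
(13.7), in the form `stub_coreIndependenceHelpers`, applied to the explicit collars
`(m, t) ↦ cᵢ (toCarrier m) t` of the subtype `∂W` on the slab `∂W × [0, 1)`).
[cite: BrockerJanich1982, (13.7)] -/
theorem openCollarData_exists_diffeomorph_apply_eq (c₁ c₂ : b.OpenCollarData) {N₀ : Set W}
    (hN₀ : IsOpen N₀) (hbN₀ : (𝓡∂ (n + 2)).boundary W ⊆ N₀) :
    ∃ Ψ : W ≃ₘ⟮𝓡∂ (n + 2), 𝓡∂ (n + 2)⟯ W, (∀ z, z ∉ N₀ → Ψ z = z) ∧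
      ∃ δ, 0 < δ ∧ ∀ x, ∀ t ∈ Ico 0 δ, Ψ (c₁.toFun x t) = c₂.toFun x t := by
  -- the explicit collar data of `cᵢ` over the subtype `∂W`, slab height `1 < top`
  have hg : ContMDiff ((𝓡 (n + 1)).prod 𝓘(ℝ, ℝ)) ((𝓡 (n + 1)).prod 𝓘(ℝ, ℝ)) ∞
      fun q : ↥((𝓡∂ (n + 2)).boundary W) × ℝ => (toCarrier b q.1, q.2) :=
    ((contMDiff_toCarrier b).comp contMDiff_fst).prodMk contMDiff_snd
  have data : ∀ c : b.OpenCollarData,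
      (∀ m : ↥((𝓡∂ (n + 2)).boundary W), c.toFun (toCarrier b m) 0 = m.val) ∧
      ContMDiffOn ((𝓡 (n + 1)).prod 𝓘(ℝ, ℝ)) (𝓡∂ (n + 2)) ∞
        (fun q : ↥((𝓡∂ (n + 2)).boundary W) × ℝ => c.toFun (toCarrier b q.1) q.2)
        (univ ×ˢ Ico 0 1) ∧
      MapsTo (fun q : ↥((𝓡∂ (n + 2)).boundary W) × ℝ => c.toFun (toCarrier b q.1) q.2)
        (univ ×ˢ Ico (0 : ℝ) 1) (c.region ∩ c.height ⁻¹' Iio 1) ∧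
      (∀ z ∈ c.region ∩ c.height ⁻¹' Iio 1,
        (ofCarrier b (c.proj z), c.height z) ∈
            (univ : Set ↥((𝓡∂ (n + 2)).boundary W)) ×ˢ Ico (0 : ℝ) 1 ∧
          c.toFun (toCarrier b (ofCarrier b (c.proj z))) (c.height z) = z) ∧
      (∀ q ∈ (univ : Set ↥((𝓡∂ (n + 2)).boundary W)) ×ˢ Ico (0 : ℝ) 1,
        (ofCarrier b (c.proj (c.toFun (toCarrier b q.1) q.2)),
          c.height (c.toFun (toCarrier b q.1) q.2)) = q) ∧
      ContMDiffOn (𝓡∂ (n + 2)) ((𝓡 (n + 1)).prod 𝓘(ℝ, ℝ)) ∞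
        (fun z => (ofCarrier b (c.proj z), c.height z)) (c.region ∩ c.height ⁻¹' Iio 1) := by
    intro c
    have h01 : ∀ {t : ℝ}, t ∈ Ico (0 : ℝ) 1 → t ∈ Ico 0 c.top := fun ht =>
      ⟨ht.1, ht.2.trans c.one_lt_top⟩
    refine ⟨fun m => ?_, ?_, ?_, fun z hz => ?_, ?_, ?_⟩
    · rw [c.apply_zero, incl_toCarrier]
    · exact c.contMDiffOn_toFun.comp hg.contMDiffOn fun q hq => ⟨mem_univ _, h01 hq.2⟩
    · rintro ⟨m, t⟩ ⟨-, ht⟩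
      refine ⟨c.mem_region _ _ (h01 ht), ?_⟩
      show c.height (c.toFun (toCarrier b m) t) < 1
      rw [c.height_apply _ _ (h01 ht)]
      exact ht.2
    · refine ⟨⟨mem_univ _, (c.height_mem z hz.1).1, hz.2⟩, ?_⟩
      rw [toCarrier_ofCarrier, c.apply_proj_height z hz.1]
    · rintro ⟨m, t⟩ ⟨-, ht⟩
      refine Prod.ext ?_ (c.height_apply _ _ (h01 ht))
      show ofCarrier b (c.proj (c.toFun (toCarrier b m) t)) = m
      rw [c.proj_apply _ _ (h01 ht), ofCarrier_toCarrier]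
    · exact (((contMDiff_ofCarrier b).comp_contMDiffOn c.contMDiffOn_proj).prodMk
        c.contMDiffOn_height).mono inter_subset_left
  obtain ⟨h₁0, h₁s, h₁U, hU₁, hi₁, hi₁s⟩ := data c₁
  obtain ⟨h₂0, h₂s, h₂U, hU₂, hi₂, hi₂s⟩ := data c₂
  obtain ⟨Ψ, -, hΨN, δ, hδ, -, -, hΨ⟩ :=
    boundary_exists_diffeomorph_comp_collar_eq_collar_of_subset (n := n + 1) hN₀ hbN₀ one_pos
      (fun q : ↥((𝓡∂ (n + 2)).boundary W) × ℝ => c₁.toFun (toCarrier b q.1) q.2)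
      (fun z => (ofCarrier b (c₁.proj z), c₁.height z)) _
      (c₁.continuousOn_height.isOpen_inter_preimage c₁.isOpen_region isOpen_Iio) h₁0 h₁s h₁U
      hU₁ hi₁ hi₁s one_pos
      (fun q : ↥((𝓡∂ (n + 2)).boundary W) × ℝ => c₂.toFun (toCarrier b q.1) q.2)
      (fun z => (ofCarrier b (c₂.proj z), c₂.height z)) _
      (c₂.continuousOn_height.isOpen_inter_preimage c₂.isOpen_region isOpen_Iio) h₂0 h₂s h₂U
      hU₂ hi₂ hi₂s
  refine ⟨Ψ, hΨN, δ, hδ, fun x t ht => ?_⟩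
  have h := hΨ (ofCarrier b x) t ht
  simp only [toCarrier_ofCarrier] at h
  exact h

end Wrapper

section ImageFacts

variable {W : Type*} {N₀ : Set W}

/-- A bijection of `W` fixing the complement of `N₀` pointwise maps `N₀` onto itself. [folklore] -/
theorem image_eq_of_forall_not_mem_apply_eq {Ψ : W ≃ W} (h : ∀ z, z ∉ N₀ → Ψ z = z) :
    Ψ '' N₀ = N₀ := by
  ext z
  constructor
  · rintro ⟨w, hw, rfl⟩
    by_contra hz
    have hw' : Ψ w = w := Ψ.injective (h (Ψ w) hz)
    exact hz (by rw [hw']; exact hw)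
  · intro hz
    by_cases hΨz : Ψ.symm z ∈ N₀
    · exact ⟨Ψ.symm z, hΨz, Ψ.apply_symm_apply z⟩
    · have h' := h _ hΨz
      rw [Ψ.apply_symm_apply] at h'
      refine ⟨z, hz, ?_⟩
      conv_lhs => rw [h']
      exact Ψ.apply_symm_apply z

end ImageFacts

end CoreIndependence

/-! ## The registered stub -/

/-- **Registered stub `stub_coreIndependence`** of line `lp-by-sphere-system-surgery`: cores of a
compact manifold with boundary do not depend on the collar.  `Φ = Q ∘ Ψ ∘ P⁻¹ ∘ Ψ⁻¹` with `Ψ`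
the collar matching supported in `N = c (∂W × [0, a))` and `P`, `Q` the pushes along `c`, `ĉ`
(module docstring). [cite: BrockerJanich1982, (13.7)] [cite: Milnor1963, Thm. 3.1] -/
theorem stub_coreIndependence : CoreIndependence := by
  intro n W _ _ _ _ _ _ b c ĉ a â ha ha1 hâ hâ1
  -- the open collar end `N₀ = c (∂W × [0, a))` is an open neighbourhood of `∂W`
  set N₀ : Set W := c.collarMap '' {p | (p.2 : ℝ) < a} with hN₀def
  have hN₀o : IsOpen N₀ := by
    rw [hN₀def, CoreIndependence.image_collarMap_lt c ha1.le]
    exact c.continuousOn_height.isOpen_inter_preimage c.isOpen_region isOpen_Iio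
  have hbN₀ : (𝓡∂ (n + 2)).boundary W ⊆ N₀ := by
    rw [← b.range_incl]
    rintro _ ⟨x, rfl⟩
    exact ⟨(x, ⟨0, le_rfl, zero_le_one⟩), ha, c.apply_zero x⟩
  -- 1. collar matching supported in `N₀`
  obtain ⟨Ψ, hΨN, δ, hδ, hΨ⟩ :=
    CoreIndependence.openCollarData_exists_diffeomorph_apply_eq b c ĉ hN₀o hbN₀
  -- 2. pushes along the two collars from a common low level `t₀ < δ`
  set t₀ : ℝ := min (δ / 2) (min a â) with ht₀def
  have ht₀pos : 0 < t₀ := lt_min (half_pos hδ) (lt_min ha hâ)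
  have ht₀δ : t₀ < δ := (min_le_left _ _).trans_lt (half_lt_self hδ)
  have ht₀a : t₀ ≤ a := (min_le_right _ _).trans (min_le_left _ _)
  have ht₀â : t₀ ≤ â := (min_le_right _ _).trans (min_le_right _ _)
  obtain ⟨P, ⟨K₁, hK₁c, hK₁i, hP⟩, hPim⟩ :=
    CoreIndependence.exists_diffeomorph_image_collar_eq c ht₀pos ht₀a ha1
  obtain ⟨Q, ⟨K₂, hK₂c, hK₂i, hQ⟩, hQim⟩ :=
    CoreIndependence.exists_diffeomorph_image_collar_eq ĉ ht₀pos ht₀â hâ1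
  -- 3. `Φ = Q ∘ Ψ ∘ P⁻¹ ∘ Ψ⁻¹`
  refine ⟨((Ψ.symm.trans P.symm).trans Ψ).trans Q, ⟨Ψ '' K₁ ∪ K₂, ?_, ?_, ?_⟩, ?_⟩
  · exact (hK₁c.image Ψ.continuous).union hK₂c
  · refine union_subset ?_ hK₂i
    exact (image_mono hK₁i).trans (Ψ.image_interior (by simp)).subset
  · intro w hw
    simp only [mem_union, not_or] at hw
    obtain ⟨hw1, hw2⟩ := hw
    have h1 : Ψ.symm w ∉ K₁ := fun h => hw1 ⟨Ψ.symm w, h, Ψ.apply_symm_apply w⟩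
    have h2 : P.symm (Ψ.symm w) = Ψ.symm w := by
      conv_lhs => rw [← hP _ h1]
      exact P.symm_apply_apply _
    show Q (Ψ (P.symm (Ψ.symm w))) = w
    rw [h2, Ψ.apply_symm_apply, hQ w hw2]
  · -- images: `N₀ ↦ N₀ ↦ c (< t₀) ↦ ĉ (< t₀) ↦ ĉ (< â)`
    have hΨN₀ : Ψ '' N₀ = N₀ :=
      CoreIndependence.image_eq_of_forall_not_mem_apply_eq (Ψ := Ψ.toEquiv) hΨN
    have hΨ'N₀ : Ψ.symm '' N₀ = N₀ := by
      conv_lhs => rw [← hΨN₀]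
      exact Ψ.symm_image_image N₀
    have hP' : P.symm '' N₀ = c.collarMap '' {p | (p.2 : ℝ) < t₀} := by
      rw [hN₀def, ← hPim]
      exact P.symm_image_image _
    have hΨt₀ : Ψ '' (c.collarMap '' {p | (p.2 : ℝ) < t₀}) = ĉ.collarMap '' {p | (p.2 : ℝ) < t₀} := by
      rw [image_image]
      exact image_congr fun p hp => hΨ p.1 p.2 ⟨p.2.2.1, lt_trans hp ht₀δ⟩
    rw [show ((((Ψ.symm.trans P.symm).trans Ψ).trans Q : W ≃ₘ⟮𝓡∂ (n + 2), 𝓡∂ (n + 2)⟯ W) :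
        W → W) = Q ∘ Ψ ∘ P.symm ∘ Ψ.symm from rfl, image_comp, image_comp, image_comp, hΨ'N₀,
      hP', hΨt₀, hQim]

end Summit.SmoothPoincare4.SmoothPoincare4.Cruxes.AgkCor6Sufficiency.LpBySphereSystemSurgery

end
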